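import Summits.Schanuel.Schanuel.Theorems.SoloInformedMixedAPIntegrality

/-!
# Mixed 3-AP defects across three integer polynomials: the analytic core (Lemma M (ii)–(iii))

Solo-informed Schanuel seat, session s191 (2026-08-31); second file (K2) of the seat's kernel
plan for the MIXED Lemma AE₃ (`work/s188/MIXED-AE3-note.md` §1, §6), companion of
`SoloInformedMixedAPIntegrality` (K1, Lemma M (i)).  Setting as there: `G₁, G₂, G₃ ∈ ℤ[X]`,
non-zero, of degrees `D₁, D₂, D₃`, leading coefficients `a_s`, complex roots `ρ_s` listed with
multiplicity, Mahler measures `M_s = |a_s| ∏ max(1, ‖ρ_s ·‖)`, and the forms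
`L t = ρ₁ t.1 + ρ₃ t.2.2 − 2 ρ₂ t.2.1` (`t ∈ Fin D₁ × Fin D₂ × Fin D₃`).

* `soloMA_prod_triples_eq` — bookkeeping:
  `∏_t 4 g₁(t.1) g₂(t.2.1) g₃(t.2.2) = 4^(D₁D₂D₃) (∏ g₁)^(D₂D₃) (∏ g₂)^(D₁D₃) (∏ g₃)^(D₁D₂)`
  (the root `ρ₁ i` sits in `D₂ D₃` triples, `ρ₂ j` in `D₁ D₃`, `ρ₃ k` in `D₁ D₂`).
* `soloMA_one_le_prod_mul_mahlerMeasure_pow` — **Lemma M (iii), multiplicative form**: for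
  any finset `T` of triples with `L t ≠ 0`,
  `1 ≤ (∏_{t ∈ T} ‖L t‖) · 4^(D₁D₂D₃) · M₁^(D₂D₃) · M₂^(D₁D₃) · M₃^(D₁D₂)`.
* `soloMA_sum_log_le` — **Lemma M (iii), logarithmic form**:
  `∑_{t ∈ T} log (1/‖L t‖) ≤ D₂D₃ log M₁ + D₁D₃ log M₂ + D₁D₂ log M₃ + D₁D₂D₃ log 4`.
* `soloMA_card_mul_log_le` — the uniform-`ε` special case
  `#T · log (1/ε) ≤ D₂D₃ log M₁ + D₁D₃ log M₂ + D₁D₂ log M₃ + D₁D₂D₃ log 4` (`‖L t‖ ≤ ε` on `T`).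

Proof: Lemma M (ii) is the tree's `soloAP_norm_lin_le`
(`‖x + z − 2y‖ ≤ 4 max(1,‖x‖) max(1,‖y‖) max(1,‖z‖)`); with `b_t ≥ 1` that bound and
`1 ≤ |c| ∏_{L t ≠ 0} ‖L t‖` (K1, `soloMI_one_le_abs_pow_mul_prod_norm`,
`c = a₁^(D₂D₃) a₂^(D₁D₃) a₃^(D₁D₂)`):
`1 ≤ |c| ∏_{T} ‖L t‖ ∏_{all t} b_t` and `|c| ∏_t b_t = 4^(D₁D₂D₃) M₁^(D₂D₃) M₂^(D₁D₃) M₃^(D₁D₂)`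
(`soloAE_mahlerMeasure_map_eq`); the powers of `|a_s|` cancel exactly.  For
`G₁ = G₂ = G₃ = F` this is the weighted AE₃ core `soloCW_sum_log_le` (price
`3 D² log M(F) + D³ log 4`).

## Why (seat bookkeeping)

Lemma M (iii) is the per-class price in the dyadic multiplicity charging of the seat's pen
theorem AE₃♯-2τ (`MIXED-AE3-note` §2 (g)): with `F_j` in one slot and `F = rad Q̃` in the other
two, `∑ log(1/‖L‖) ≤ D_F² log M(F_j) + 2 D_j D_F log M(F) + D_j D_F² log 4`, and the class
weight `2^j` is compensated by `2^j D_j ≤ N`, `2^j log M(F_j) ≤ log M(Q̃)` — which a one-polynomial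
Lemma AE₃ on `F_j · F` cannot do.  Toy layer only (node `RoyAdditiveDirichletExponent`,
[cite: Roy2010, Thm 1.1]); nothing here bears on `Literature.Periods.SchanuelConjecture`; the
seat's verdict (no path) is unchanged.  Classical device ([cite: Baker1975, Ch. 8 §3, p. 84]); no
novelty claimed; Mathlib + the seat files only; no definitions; no literature hypotheses; standard
axioms.
-/

namespace Summit.Schanuel.Schanuel.Theorems

open Finset Polynomial

section Bookkeeping

variable {D₁ D₂ D₃ : ℕ}

/-- Triple-product bookkeeping:
`∏_t 4 g₁(t.1) g₂(t.2.1) g₃(t.2.2) = 4^(D₁D₂D₃) (∏ g₁)^(D₂D₃) (∏ g₂)^(D₁D₃) (∏ g₃)^(D₁D₂)`. -/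
theorem soloMA_prod_triples_eq (g₁ : Fin D₁ → ℝ) (g₂ : Fin D₂ → ℝ) (g₃ : Fin D₃ → ℝ) :
    ∏ t : Fin D₁ × Fin D₂ × Fin D₃, (4 * g₁ t.1 * g₂ t.2.1 * g₃ t.2.2)
      = 4 ^ (D₁ * D₂ * D₃) * (∏ i, g₁ i) ^ (D₂ * D₃) * (∏ j, g₂ j) ^ (D₁ * D₃)
        * (∏ k, g₃ k) ^ (D₁ * D₂) := by
  simp only [Finset.prod_mul_distrib, Fintype.prod_prod_type, Finset.prod_const,
    Finset.card_univ, Fintype.card_fin, Finset.prod_pow, Fintype.card_prod]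
  ring

end Bookkeeping

section Main

variable {D₁ D₂ D₃ : ℕ}

/-- **Lemma M (iii), multiplicative form.**  For any finset `T` of triples with `L t ≠ 0`:
`1 ≤ (∏_{t ∈ T} ‖L t‖) · 4^(D₁D₂D₃) · M₁^(D₂D₃) · M₂^(D₁D₃) · M₃^(D₁D₂)`. -/
theorem soloMA_one_le_prod_mul_mahlerMeasure_pow (G₁ G₂ G₃ : ℤ[X]) (hG₁ : G₁ ≠ 0)
    (hG₂ : G₂ ≠ 0) (hG₃ : G₃ ≠ 0) (hD₁ : G₁.natDegree = D₁) (hD₂ : G₂.natDegree = D₂)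
    (hD₃ : G₃.natDegree = D₃) (ρ₁ : Fin D₁ → ℂ) (ρ₂ : Fin D₂ → ℂ) (ρ₃ : Fin D₃ → ℂ)
    (hρ₁ : univ.val.map ρ₁ = (G₁.map (Int.castRingHom ℂ)).roots)
    (hρ₂ : univ.val.map ρ₂ = (G₂.map (Int.castRingHom ℂ)).roots)
    (hρ₃ : univ.val.map ρ₃ = (G₃.map (Int.castRingHom ℂ)).roots)
    (L : Fin D₁ × Fin D₂ × Fin D₃ → ℂ) (hL : ∀ t, L t = ρ₁ t.1 + ρ₃ t.2.2 - 2 * ρ₂ t.2.1)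
    (T : Finset (Fin D₁ × Fin D₂ × Fin D₃)) (hT : ∀ t ∈ T, L t ≠ 0) :
    1 ≤ (∏ t ∈ T, ‖L t‖) * 4 ^ (D₁ * D₂ * D₃)
      * (G₁.map (Int.castRingHom ℂ)).mahlerMeasure ^ (D₂ * D₃)
      * (G₂.map (Int.castRingHom ℂ)).mahlerMeasure ^ (D₁ * D₃)
      * (G₃.map (Int.castRingHom ℂ)).mahlerMeasure ^ (D₁ * D₂) := by
  classical
  obtain ⟨g₁, hg₁⟩ : ∃ g : Fin D₁ → ℝ, ∀ l, g l = max 1 ‖ρ₁ l‖ := ⟨_, fun _ => rfl⟩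
  obtain ⟨g₂, hg₂⟩ : ∃ g : Fin D₂ → ℝ, ∀ l, g l = max 1 ‖ρ₂ l‖ := ⟨_, fun _ => rfl⟩
  obtain ⟨g₃, hg₃⟩ : ∃ g : Fin D₃ → ℝ, ∀ l, g l = max 1 ‖ρ₃ l‖ := ⟨_, fun _ => rfl⟩
  obtain ⟨J, hJ⟩ : ∃ J : Finset (Fin D₁ × Fin D₂ × Fin D₃),
      J = univ.filter (fun t => L t ≠ 0) := ⟨_, rfl⟩
  have h1g₁ : ∀ l, 1 ≤ g₁ l := fun l => by rw [hg₁]; exact le_max_left _ _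
  have h1g₂ : ∀ l, 1 ≤ g₂ l := fun l => by rw [hg₂]; exact le_max_left _ _
  have h1g₃ : ∀ l, 1 ≤ g₃ l := fun l => by rw [hg₃]; exact le_max_left _ _
  have hB1 : ∀ t : Fin D₁ × Fin D₂ × Fin D₃, 1 ≤ 4 * g₁ t.1 * g₂ t.2.1 * g₃ t.2.2 := by
    intro t
    have h := one_le_mul_of_one_le_of_one_le
      (one_le_mul_of_one_le_of_one_le (h1g₁ t.1) (h1g₂ t.2.1)) (h1g₃ t.2.2)
    linarith
  have hTJ : T ⊆ J := fun t ht => by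
    rw [hJ]; exact Finset.mem_filter.mpr ⟨Finset.mem_univ _, hT t ht⟩
  -- Lemma M (i): the integrality lower bound
  have hMI := soloMI_one_le_abs_pow_mul_prod_norm G₁ G₂ G₃ hG₁ hG₂ hG₃ hD₁ hD₂ hD₃ ρ₁ ρ₂ ρ₃
    hρ₁ hρ₂ hρ₃ L hL
  rw [← hJ] at hMI
  -- Lemma M (ii): the trivial upper bound for each form
  have hLle : ∀ t, ‖L t‖ ≤ 4 * g₁ t.1 * g₂ t.2.1 * g₃ t.2.2 := by
    intro t
    rw [hL, hg₁, hg₂, hg₃]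
    exact soloAP_norm_lin_le (ρ₁ t.1) (ρ₂ t.2.1) (ρ₃ t.2.2)
  have hT0 : 0 ≤ ∏ t ∈ T, ‖L t‖ := Finset.prod_nonneg fun _ _ => norm_nonneg _
  have hstep : ∏ t ∈ J, ‖L t‖ ≤ (∏ t ∈ T, ‖L t‖) *
      ∏ t : Fin D₁ × Fin D₂ × Fin D₃, (4 * g₁ t.1 * g₂ t.2.1 * g₃ t.2.2) := by
    calc ∏ t ∈ J, ‖L t‖
        = (∏ t ∈ T, ‖L t‖) * ∏ t ∈ J \ T, ‖L t‖ := by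
          rw [← Finset.prod_sdiff hTJ, mul_comm]
      _ ≤ (∏ t ∈ T, ‖L t‖) * ∏ t ∈ J \ T, (4 * g₁ t.1 * g₂ t.2.1 * g₃ t.2.2) :=
          mul_le_mul_of_nonneg_left
            (Finset.prod_le_prod (fun t _ => norm_nonneg _) (fun t _ => hLle t)) hT0
      _ ≤ (∏ t ∈ T, ‖L t‖) *
            ∏ t : Fin D₁ × Fin D₂ × Fin D₃, (4 * g₁ t.1 * g₂ t.2.1 * g₃ t.2.2) :=
          mul_le_mul_of_nonneg_left (Finset.prod_le_prod_of_subset_of_one_le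
            (Finset.subset_univ _) (fun t _ => zero_le_one.trans (hB1 t))
            (fun t _ _ => hB1 t)) hT0
  have htriples := soloMA_prod_triples_eq g₁ g₂ g₃
  have hM₁ : (G₁.map (Int.castRingHom ℂ)).mahlerMeasure = |(G₁.leadingCoeff : ℝ)| * ∏ l, g₁ l := by
    rw [soloAE_mahlerMeasure_map_eq G₁ ρ₁ hρ₁]
    simp only [hg₁]
  have hM₂ : (G₂.map (Int.castRingHom ℂ)).mahlerMeasure = |(G₂.leadingCoeff : ℝ)| * ∏ l, g₂ l := by
    rw [soloAE_mahlerMeasure_map_eq G₂ ρ₂ hρ₂]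
    simp only [hg₂]
  have hM₃ : (G₃.map (Int.castRingHom ℂ)).mahlerMeasure = |(G₃.leadingCoeff : ℝ)| * ∏ l, g₃ l := by
    rw [soloAE_mahlerMeasure_map_eq G₃ ρ₃ hρ₃]
    simp only [hg₃]
  rw [hM₁, hM₂, hM₃]
  calc (1 : ℝ) ≤ |(G₁.leadingCoeff : ℝ)| ^ (D₂ * D₃) * |(G₂.leadingCoeff : ℝ)| ^ (D₁ * D₃)
        * |(G₃.leadingCoeff : ℝ)| ^ (D₁ * D₂) * ∏ t ∈ J, ‖L t‖ := hMI
    _ ≤ |(G₁.leadingCoeff : ℝ)| ^ (D₂ * D₃) * |(G₂.leadingCoeff : ℝ)| ^ (D₁ * D₃)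
        * |(G₃.leadingCoeff : ℝ)| ^ (D₁ * D₂) * ((∏ t ∈ T, ‖L t‖) *
          (4 ^ (D₁ * D₂ * D₃) * (∏ i, g₁ i) ^ (D₂ * D₃) * (∏ j, g₂ j) ^ (D₁ * D₃)
            * (∏ k, g₃ k) ^ (D₁ * D₂))) := by
        refine mul_le_mul_of_nonneg_left ?_ (by positivity)
        rw [← htriples]
        exact hstep
    _ = (∏ t ∈ T, ‖L t‖) * 4 ^ (D₁ * D₂ * D₃)
        * (|(G₁.leadingCoeff : ℝ)| * ∏ l, g₁ l) ^ (D₂ * D₃)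
        * (|(G₂.leadingCoeff : ℝ)| * ∏ l, g₂ l) ^ (D₁ * D₃)
        * (|(G₃.leadingCoeff : ℝ)| * ∏ l, g₃ l) ^ (D₁ * D₂) := by ring

/-- **Lemma M (iii), logarithmic form.**  For any finset `T` of triples with `L t ≠ 0`:
`∑_{t ∈ T} log (1/‖L t‖) ≤ D₂D₃ log M₁ + D₁D₃ log M₂ + D₁D₂ log M₃ + D₁D₂D₃ log 4`. -/
theorem soloMA_sum_log_le (G₁ G₂ G₃ : ℤ[X]) (hG₁ : G₁ ≠ 0) (hG₂ : G₂ ≠ 0) (hG₃ : G₃ ≠ 0)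
    (hD₁ : G₁.natDegree = D₁) (hD₂ : G₂.natDegree = D₂) (hD₃ : G₃.natDegree = D₃)
    (ρ₁ : Fin D₁ → ℂ) (ρ₂ : Fin D₂ → ℂ) (ρ₃ : Fin D₃ → ℂ)
    (hρ₁ : univ.val.map ρ₁ = (G₁.map (Int.castRingHom ℂ)).roots)
    (hρ₂ : univ.val.map ρ₂ = (G₂.map (Int.castRingHom ℂ)).roots)
    (hρ₃ : univ.val.map ρ₃ = (G₃.map (Int.castRingHom ℂ)).roots)
    (L : Fin D₁ × Fin D₂ × Fin D₃ → ℂ) (hL : ∀ t, L t = ρ₁ t.1 + ρ₃ t.2.2 - 2 * ρ₂ t.2.1)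
    (T : Finset (Fin D₁ × Fin D₂ × Fin D₃)) (hT : ∀ t ∈ T, L t ≠ 0) :
    ∑ t ∈ T, Real.log (1 / ‖L t‖) ≤
      ((D₂ * D₃ : ℕ) : ℝ) * Real.log (G₁.map (Int.castRingHom ℂ)).mahlerMeasure
        + ((D₁ * D₃ : ℕ) : ℝ) * Real.log (G₂.map (Int.castRingHom ℂ)).mahlerMeasure
        + ((D₁ * D₂ : ℕ) : ℝ) * Real.log (G₃.map (Int.castRingHom ℂ)).mahlerMeasure
        + ((D₁ * D₂ * D₃ : ℕ) : ℝ) * Real.log 4 := by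
  have h := soloMA_one_le_prod_mul_mahlerMeasure_pow G₁ G₂ G₃ hG₁ hG₂ hG₃ hD₁ hD₂ hD₃ ρ₁ ρ₂ ρ₃
    hρ₁ hρ₂ hρ₃ L hL T hT
  have hM₁ : 0 < (G₁.map (Int.castRingHom ℂ)).mahlerMeasure :=
    Polynomial.mahlerMeasure_pos_of_ne_zero
      ((Polynomial.map_ne_zero_iff (Int.castRingHom ℂ).injective_int).mpr hG₁)
  have hM₂ : 0 < (G₂.map (Int.castRingHom ℂ)).mahlerMeasure :=
    Polynomial.mahlerMeasure_pos_of_ne_zero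
      ((Polynomial.map_ne_zero_iff (Int.castRingHom ℂ).injective_int).mpr hG₂)
  have hM₃ : 0 < (G₃.map (Int.castRingHom ℂ)).mahlerMeasure :=
    Polynomial.mahlerMeasure_pos_of_ne_zero
      ((Polynomial.map_ne_zero_iff (Int.castRingHom ℂ).injective_int).mpr hG₃)
  have hLpos : ∀ t ∈ T, 0 < ‖L t‖ := fun t ht => norm_pos_iff.mpr (hT t ht)
  have hTpos : 0 < ∏ t ∈ T, ‖L t‖ := Finset.prod_pos hLpos
  have hP0 : 0 < (∏ t ∈ T, ‖L t‖) * 4 ^ (D₁ * D₂ * D₃) := mul_pos hTpos (by positivity)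
  have hP1 : 0 < (∏ t ∈ T, ‖L t‖) * 4 ^ (D₁ * D₂ * D₃)
      * (G₁.map (Int.castRingHom ℂ)).mahlerMeasure ^ (D₂ * D₃) := mul_pos hP0 (pow_pos hM₁ _)
  have hP2 : 0 < (∏ t ∈ T, ‖L t‖) * 4 ^ (D₁ * D₂ * D₃)
      * (G₁.map (Int.castRingHom ℂ)).mahlerMeasure ^ (D₂ * D₃)
      * (G₂.map (Int.castRingHom ℂ)).mahlerMeasure ^ (D₁ * D₃) := mul_pos hP1 (pow_pos hM₂ _)
  have hlog := Real.log_le_log one_pos h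
  rw [Real.log_one, Real.log_mul hP2.ne' (pow_pos hM₃ _).ne',
    Real.log_mul hP1.ne' (pow_pos hM₂ _).ne', Real.log_mul hP0.ne' (pow_pos hM₁ _).ne',
    Real.log_mul hTpos.ne' (by positivity), Real.log_pow, Real.log_pow, Real.log_pow,
    Real.log_pow, Real.log_prod (fun t ht => (hLpos t ht).ne')] at hlog
  have hsum : ∑ t ∈ T, Real.log (1 / ‖L t‖) = -∑ t ∈ T, Real.log ‖L t‖ := by
    rw [← Finset.sum_neg_distrib]
    refine Finset.sum_congr rfl (fun t _ => ?_)
    rw [one_div, Real.log_inv]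
  rw [hsum]
  push_cast at hlog ⊢
  linarith

/-- **Lemma M (iii), uniform form.**  If moreover `‖L t‖ ≤ ε` on `T` (`0 < ε`):
`#T · log (1/ε) ≤ D₂D₃ log M₁ + D₁D₃ log M₂ + D₁D₂ log M₃ + D₁D₂D₃ log 4`. -/
theorem soloMA_card_mul_log_le (G₁ G₂ G₃ : ℤ[X]) (hG₁ : G₁ ≠ 0) (hG₂ : G₂ ≠ 0) (hG₃ : G₃ ≠ 0)
    (hD₁ : G₁.natDegree = D₁) (hD₂ : G₂.natDegree = D₂) (hD₃ : G₃.natDegree = D₃)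
    (ρ₁ : Fin D₁ → ℂ) (ρ₂ : Fin D₂ → ℂ) (ρ₃ : Fin D₃ → ℂ)
    (hρ₁ : univ.val.map ρ₁ = (G₁.map (Int.castRingHom ℂ)).roots)
    (hρ₂ : univ.val.map ρ₂ = (G₂.map (Int.castRingHom ℂ)).roots)
    (hρ₃ : univ.val.map ρ₃ = (G₃.map (Int.castRingHom ℂ)).roots)
    (L : Fin D₁ × Fin D₂ × Fin D₃ → ℂ) (hL : ∀ t, L t = ρ₁ t.1 + ρ₃ t.2.2 - 2 * ρ₂ t.2.1)
    {ε : ℝ} (hε : 0 < ε) (T : Finset (Fin D₁ × Fin D₂ × Fin D₃))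
    (hT : ∀ t ∈ T, L t ≠ 0 ∧ ‖L t‖ ≤ ε) :
    (#T : ℝ) * Real.log (1 / ε) ≤
      ((D₂ * D₃ : ℕ) : ℝ) * Real.log (G₁.map (Int.castRingHom ℂ)).mahlerMeasure
        + ((D₁ * D₃ : ℕ) : ℝ) * Real.log (G₂.map (Int.castRingHom ℂ)).mahlerMeasure
        + ((D₁ * D₂ : ℕ) : ℝ) * Real.log (G₃.map (Int.castRingHom ℂ)).mahlerMeasure
        + ((D₁ * D₂ * D₃ : ℕ) : ℝ) * Real.log 4 := by
  have h := soloMA_sum_log_le G₁ G₂ G₃ hG₁ hG₂ hG₃ hD₁ hD₂ hD₃ ρ₁ ρ₂ ρ₃ hρ₁ hρ₂ hρ₃ L hL T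
    (fun t ht => (hT t ht).1)
  refine le_trans ?_ h
  have hterm : ∀ t ∈ T, Real.log (1 / ε) ≤ Real.log (1 / ‖L t‖) := by
    intro t ht
    have hLpos : 0 < ‖L t‖ := norm_pos_iff.mpr (hT t ht).1
    exact Real.log_le_log (by positivity)
      (one_div_le_one_div_of_le hLpos (hT t ht).2)
  calc (#T : ℝ) * Real.log (1 / ε) = ∑ _t ∈ T, Real.log (1 / ε) := by
        rw [Finset.sum_const, nsmul_eq_mul]
    _ ≤ ∑ t ∈ T, Real.log (1 / ‖L t‖) := Finset.sum_le_sum hterm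

end Main

end Summit.Schanuel.Schanuel.Theorems
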